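import Summits.QuantumFields.YangMills.Theorems.AllWindowsColdBoxBoxHighLineK3PrimeRowSumRows
import Summits.QuantumFields.YangMills.Theorems.AllWindowsColdBoxBoxHighLineRestrictionSetCum3Sup
import Summits.QuantumFields.YangMills.Theorems.AllWindowsColdBoxBoxHighLinePlaquetteObsL2ByName
import Summits.QuantumFields.YangMills.Theorems.AllWindowsColdBoxBoxHighLineK4PrimeRowR3R4

/-!
# U5 K3′ — row RC of the hK3 ROW SUM, BY NAME (per-row `hKk` currency): the parity survivors of the `N`-row
# (K3′ term table of record = HOME bus 2026-08-30T01:19:30Z, adopted by planner ym-idea-2 g18 01:19:49Z; planner g19 02:10:18Z «hRC reverts to fcl-p3»; LINE-20 U5 ⟨stmt-QuantumFields-24336⟩)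

Free-hands helper of the κ-lineage (ym-line-fcl-p3 g27).  Row RC of ✓`tiltCum3_cutSet_size_of_rows` (`…K3PrimeRowSum`) is
`|κ₃(cᵉ_x, cᵒ_y; N) + κ₃(cᵒ_x, cᵉ_y; N)|` with the tilt remainder `N a := (tiltU a − tiltU(−a))/2 − P a` (`P = β·Σ_p tripleForm (Tc p)(plaqVar_p)` the record cubic
polynomial, «P first»).  On the cut set `D ⊆ smallField H s`, `s = β^{(1/8−θ/4)−1/2}`:
`sup_D |N| ≤ ν := C_g·H⁶(1+log H)^m·s³ + (max Cr 0)·β·H⁴·s⁵` (w2 g33's ✓`GaussNormalForm.abs_tiltU_odd_add_cubicVertex_le` — the odd ghost tail, needs `s·H² ≤ c₀`,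
eventually true by ✓`AssemblyBudget.side_budget` — plus the record `|cubicVertex + P| ≤ Cr·β·H⁴·s⁵`), the even plaquette part by sup `|cᵉ| ≤ 116 s²`
(✓`TiltSup.abs_chartPlaqCost_le` at `a` and `−a`), the odd part in `L²`: `√(2E₀[1_D (cᵒ)²]) ≤ √(2C)·β⁻¹√(β⁻¹)` (`K3RowSum.sqrt_two_mul_gaussAvg_indicator_odd_sq_le`, here, from ✓`plaquetteObsL2`),
assembled with the «sup on the tilt slot» tool ✓`GaussRestrict.abs_tiltCum3_muSet_zero_le_of_sup_third`:

* `K3RowSum.sqrt_two_mul_gaussAvg_indicator_odd_sq_le`, `K3RowSum.sqrt_two_mul_gaussAvg_indicator_even_sq_le` — `√(2E₀[1_D (cᵒ − 0)²]) ≤ √(2C)·β⁻¹√(β⁻¹)` and `√(2E₀[1_D (cᵉ − 0)²]) ≤ √2·116·s²` on `D ⊆ smallField H s`, `s ≤ 1`;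
* ★ `K3RowSum.rowBound_RC` — `q := 1`, `K β H := 4·ν·(√2·116·s²)·(√(2C)·β⁻¹·√(β⁻¹))`; budget `β²H⁸K = C₁·H¹⁴L^m·s⁵·β^{1/2} + C₂·H¹²·s⁷·β^{3/2}`, exponent rows at
  `κ₃ = 1/8−θ/4`: `14θ + 1/2 + 5(κ₃−1/2) = 12.75θ − 1.375 < 0 ⟺ θ < 0.1078` ✓ and `12θ + 3/2 + 7(κ₃−1/2) = 10.25θ − 1.125 < 0 ⟺ θ < 0.1097` ✓ — strict for every
  `θ < 1/10` (✓`budget_monomial`, `(k,j,a) = (14,5,1/2), (12,7,3/2)`).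

No definitions; tree only; standard axioms.  HONEST LABEL: helper-grade U5 prep (one row of hK3 by name; hK3 itself is NOT proved — E1r, RA, RB remain hypotheses); U5,
⟨24336⟩, ⟨24004⟩ remain OPEN; route AllWindowsColdBox is DRAFT; no crux, rung or summit is proved; **the Yang–Mills mass gap is NOT proved by this file; no summit is
proved by a line.**
-/

set_option autoImplicit false

noncomputable section

open MeasureTheory
open Literature.Probability.LatticeModels (Site)
open Literature.MathematicalPhysics.QuantumLattice (ZdPlaquette plaquettesTouching)
open Literature.MathematicalPhysics.QuantumFieldTheory.AxialGauge (boxEdges)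
open Summit.QuantumFields.YangMills.Theorems.WeakCouplingRates (plaq12At)

namespace Summit.QuantumFields.YangMills.Theorems.AllWindowsColdBoxBoxHighLine

namespace K3RowSum

open AssemblyBudget ErrorBudget

/-- `√(2·E₀[1_D·(c^{odd} − 0)²]) ≤ √(2C)·β^{−1}·√(β^{−1})` (✓`plaquetteObsL2`, `β ≥ 1`). -/
theorem sqrt_two_mul_gaussAvg_indicator_odd_sq_le : ∃ C : ℝ, 0 ≤ C ∧ ∀ H : ℕ, 1 ≤ H → ∀ β : ℝ, 1 ≤ β →
    ∀ D : Set (LandauFree H → E3), ∀ z : Site 4,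
      Real.sqrt (2 * gaussAvg β H (fun a => D.indicator (fun _ => (1 : ℝ)) a * (chartPlaqCostOdd H z 1 2 a - 0) ^ 2)) ≤
        Real.sqrt (2 * C) * (β ^ (-(1 : ℝ)) * Real.sqrt (β ^ (-(1 : ℝ)))) := by
  obtain ⟨C, hC⟩ := plaquetteObsL2
  have hC0 : 0 ≤ C := by
    have h := (hC 1 le_rfl 1 le_rfl 0).1
    have h0 : 0 ≤ gaussAvg 1 1 (fun a => linCurvSq 1 (plaq12At 0) a ^ 2) := EdgeChartGaussian.gaussAvg_nonneg 1 one_pos fun a => sq_nonneg _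
    have : (0 : ℝ) ≤ C / 1 ^ 2 := h0.trans h
    simpa using this
  refine ⟨C, hC0, fun H hH β hβ D z => ?_⟩
  have hβ0 : 0 < β := by linarith
  have h1 : gaussAvg β H (fun a => D.indicator (fun _ => (1 : ℝ)) a * (chartPlaqCostOdd H z 1 2 a - 0) ^ 2) ≤ C / β ^ 3 := by
    refine le_trans (EdgeChartGaussian.gaussAvg_mono_of_nonneg H hβ0 (fun a => mul_nonneg (GaussRestrict.indicator_one_nonneg_le_one D a).1 (sq_nonneg _))
      (fun a => ?_) ?_) (hC H hH β hβ z).2.1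
    · rw [sub_zero]
      calc D.indicator (fun _ => (1 : ℝ)) a * chartPlaqCostOdd H z 1 2 a ^ 2 ≤ 1 * chartPlaqCostOdd H z 1 2 a ^ 2 :=
          mul_le_mul_of_nonneg_right (GaussRestrict.indicator_one_nonneg_le_one D a).2 (sq_nonneg _)
        _ = _ := one_mul _
    · exact Tilt.integrable_bdd_mul_gaussWeight H hβ0 ((EdgeChartGaussian.measurable_chartPlaqCostOdd H z 1 2).pow_const 2) (C := 4 ^ 2) fun a => by
        rw [abs_pow]; exact pow_le_pow_left₀ (abs_nonneg _) (EdgeChartGaussian.abs_chartPlaqCostOdd_le H z 1 2 a) 2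
  have hi0 : 0 ≤ β ^ (-(1 : ℝ)) := Real.rpow_nonneg hβ0.le _
  have hM : 0 ≤ Real.sqrt (2 * C) * (β ^ (-(1 : ℝ)) * Real.sqrt (β ^ (-(1 : ℝ)))) := by positivity
  have hsq : (Real.sqrt (2 * C) * (β ^ (-(1 : ℝ)) * Real.sqrt (β ^ (-(1 : ℝ))))) ^ 2 = 2 * (C / β ^ 3) := by
    rw [mul_pow, mul_pow, Real.sq_sqrt (by positivity), Real.sq_sqrt hi0, Real.rpow_neg_one, inv_pow, div_eq_mul_inv]; ring
  calc Real.sqrt (2 * gaussAvg β H (fun a => D.indicator (fun _ => (1 : ℝ)) a * (chartPlaqCostOdd H z 1 2 a - 0) ^ 2))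
      ≤ Real.sqrt ((Real.sqrt (2 * C) * (β ^ (-(1 : ℝ)) * Real.sqrt (β ^ (-(1 : ℝ))))) ^ 2) := Real.sqrt_le_sqrt (by rw [hsq]; linarith)
    _ = Real.sqrt (2 * C) * (β ^ (-(1 : ℝ)) * Real.sqrt (β ^ (-(1 : ℝ)))) := Real.sqrt_sq hM

/-- `√(2·E₀[1_D·(cᵉ − 0)²]) ≤ √2·116·s²` for `D ⊆ smallField H s`, `0 ≤ s ≤ 1` (`cᵉ = c − cᵒ = (c(a) + c(−a))/2`, sup ✓`TiltSup.abs_chartPlaqCost_le` at `±a`). -/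
theorem sqrt_two_mul_gaussAvg_indicator_even_sq_le (H : ℕ) {β : ℝ} (hβ : 0 < β) {s : ℝ} (hs0 : 0 ≤ s) (hs1 : s ≤ 1)
    {D : Set (LandauFree H → E3)} (hDs : D ⊆ smallField H s) (z : Site 4) :
    Real.sqrt (2 * gaussAvg β H (fun a => D.indicator (fun _ => (1 : ℝ)) a * (chartPlaqCost H z 1 2 a - chartPlaqCostOdd H z 1 2 a - 0) ^ 2)) ≤
      Real.sqrt 2 * 116 * s ^ 2 := by
  have hsup : ∀ a ∈ D, |chartPlaqCost H z 1 2 a - chartPlaqCostOdd H z 1 2 a| ≤ 116 * s ^ 2 := fun a ha => by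
    have e : chartPlaqCost H z 1 2 a - chartPlaqCostOdd H z 1 2 a = (chartPlaqCost H z 1 2 a + chartPlaqCost H z 1 2 (-a)) / 2 := by
      unfold chartPlaqCostOdd; ring
    rw [e, abs_div, abs_two]
    have h1 := TiltSup.abs_chartPlaqCost_le hs0 hs1 (hDs ha) z 1 2
    have h2 := TiltSup.abs_chartPlaqCost_le hs0 hs1 ((EdgeChartGaussian.neg_mem_smallField_iff s a).2 (hDs ha)) z 1 2
    linarith [abs_add_le (chartPlaqCost H z 1 2 a) (chartPlaqCost H z 1 2 (-a))]
  have h1 : gaussAvg β H (fun a => D.indicator (fun _ => (1 : ℝ)) a * (chartPlaqCost H z 1 2 a - chartPlaqCostOdd H z 1 2 a - 0) ^ 2) ≤ (116 * s ^ 2) ^ 2 := by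
    have h := EdgeChartGaussian.gaussAvg_mono_of_nonneg H hβ (F := fun a => D.indicator (fun _ => (1 : ℝ)) a * (chartPlaqCost H z 1 2 a - chartPlaqCostOdd H z 1 2 a - 0) ^ 2)
      (G := fun _ => (116 * s ^ 2) ^ 2) (fun a => mul_nonneg (GaussRestrict.indicator_one_nonneg_le_one D a).1 (sq_nonneg _)) (fun a => ?_)
      ((EdgeChartGaussian.integrable_gaussWeight H hβ).const_mul _)
    · rwa [EdgeChartGaussian.gaussAvg_const_fun H hβ] at h
    · by_cases ha : a ∈ D
      · rw [Set.indicator_of_mem ha, one_mul, sub_zero, ← sq_abs]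
        exact pow_le_pow_left₀ (abs_nonneg _) (hsup a ha) 2
      · rw [Set.indicator_of_notMem ha, zero_mul]; positivity
  have hM : 0 ≤ Real.sqrt 2 * 116 * s ^ 2 := by positivity
  have hsq : (Real.sqrt 2 * 116 * s ^ 2) ^ 2 = 2 * (116 * s ^ 2) ^ 2 := by
    rw [mul_pow, mul_pow, Real.sq_sqrt (by norm_num : (0 : ℝ) ≤ 2)]; ring
  calc Real.sqrt (2 * gaussAvg β H (fun a => D.indicator (fun _ => (1 : ℝ)) a * (chartPlaqCost H z 1 2 a - chartPlaqCostOdd H z 1 2 a - 0) ^ 2))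
      ≤ Real.sqrt ((Real.sqrt 2 * 116 * s ^ 2) ^ 2) := Real.sqrt_le_sqrt (by rw [hsq]; linarith)
    _ = _ := Real.sqrt_sq hM

/-- ★ **Row RC (the parity survivors `κ₃(cᵉ_x, cᵒ_y; N) + κ₃(cᵒ_x, cᵉ_y; N)` of the `N`-row) in the per-row `hKk` currency, BY NAME.** -/
theorem rowBound_RC : ∀ θ : ℝ, 0 < θ → θ < 1 / 10 → ∀ B Cr : ℝ, ∀ Tc : ZdPlaquette 4 → Fin 4 → Fin 4 → Fin 4 → ℝ, (∀ p i j k, |Tc p i j k| ≤ B) →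
      (∀ H : ℕ, 1 ≤ H → ∀ β : ℝ, 0 < β → ∀ s : ℝ, 0 ≤ s → ∀ a ∈ smallField H s,
        |cubicVertex β H a + β * ∑ p ∈ plaquettesTouching (boxEdges 4 (2 * H + 1)), tripleForm (Tc p) (plaqVar H p.1 p.2.1.1 p.2.1.2 a)| ≤
          Cr * β * (H : ℝ) ^ 4 * s ^ 5) →
      ∀ B₀ C₀ : ℝ, ∀ T₀ : Fin 4 → Fin 4 → Fin 4 → ℝ, (∀ i j k, |T₀ i j k| ≤ B₀) →
      (∀ (H : ℕ) (x : Site 4) (t : ℝ) (a : LandauFree H → E3), 0 ≤ t → t ≤ 1 → (∀ i, ‖plaqVar H x 1 2 a i‖ ≤ t) →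
        |chartPlaqCostOdd H x 1 2 a - tripleForm T₀ (plaqVar H x 1 2 a)| ≤ C₀ * t ^ 5) →
      ∃ q : ℝ, ∃ K : ℝ → ℕ → ℝ,
      (∃ β₀ : ℝ, 1 ≤ β₀ ∧ ∀ β : ℝ, β₀ ≤ β → ∀ H : ℕ, 1 ≤ H → β ^ θ ≤ (H : ℝ) → (H : ℝ) ≤ β ^ θ + 1 →
        ∀ D : Set (LandauFree H → E3), MeasurableSet D → D ⊆ smallField H (β ^ ((1 / 8 - θ / 4) - 1 / 2)) → (∀ a, -a ∈ D ↔ a ∈ D) →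
        gaussAvg β H (fun a => 1 - D.indicator (fun _ => (1 : ℝ)) a) ≤ β ^ (-q) →
        gaussAvg β H (fun a => 1 - D.indicator (fun _ => (1 : ℝ)) a) ≤ 1 / 2 → (∀ a ∈ D, |tiltU β H a| ≤ 2) → ∀ x y : Site 4,
        let μD : Measure (LandauFree H → E3) := ((volume : Measure (LandauFree H → E3)).restrict D).withDensity fun a => ENNReal.ofReal (gaussWeight β H a)
        let P : (LandauFree H → E3) → ℝ := fun a => β * ∑ p ∈ plaquettesTouching (boxEdges 4 (2 * H + 1)), tripleForm (Tc p) (plaqVar H p.1 p.2.1.1 p.2.1.2 a)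
        let N : (LandauFree H → E3) → ℝ := fun a => (tiltU β H a - tiltU β H (-a)) / 2 - P a
        |Tilt.tiltCum3 μD N 0 (fun a => chartPlaqCost H x 1 2 a - chartPlaqCostOdd H x 1 2 a) (chartPlaqCostOdd H y 1 2) +
            Tilt.tiltCum3 μD N 0 (chartPlaqCostOdd H x 1 2) (fun a => chartPlaqCost H y 1 2 a - chartPlaqCostOdd H y 1 2 a)| ≤ K β H) ∧
      (∀ ε : ℝ, 0 < ε → ∃ β₀ : ℝ, 1 ≤ β₀ ∧ ∀ β : ℝ, β₀ ≤ β → ∀ H : ℕ, 1 ≤ H → (H : ℝ) ≤ β ^ θ + 1 → β ^ 2 * (H : ℝ) ^ 8 * K β H ≤ ε) := by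
  intro θ hθ hθ' B Cr Tc hTc hrem B₀ C₀ T₀ _ _
  obtain ⟨CL, hCL0, hO⟩ := sqrt_two_mul_gaussAvg_indicator_odd_sq_le
  obtain ⟨Cg, c₀, m, hCg0, hc₀, hG⟩ := GaussNormalForm.abs_tiltU_odd_add_cubicVertex_le
  obtain ⟨b₀, hb₀, hside⟩ := side_budget (κ₃ := 1 / 8 - θ / 4) (c := c₀) hθ (by linarith) (by linarith) hc₀ 0
  refine ⟨1, fun β H => 4 * (Cg * (H : ℝ) ^ 6 * (1 + Real.log H) ^ m * (β ^ ((1 / 8 - θ / 4) - 1 / 2)) ^ 3 +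
        max Cr 0 * β ^ (1 : ℝ) * (H : ℝ) ^ 4 * (β ^ ((1 / 8 - θ / 4) - 1 / 2)) ^ 5) *
      (Real.sqrt 2 * 116 * (β ^ ((1 / 8 - θ / 4) - 1 / 2)) ^ 2) * (Real.sqrt (2 * CL) * (β ^ (-(1 : ℝ)) * Real.sqrt (β ^ (-(1 : ℝ))))),
    ⟨max b₀ 2, (show (1 : ℝ) ≤ 2 by norm_num).trans (le_max_right _ _), ?_⟩, ?_⟩
  · intro β hβ H hH hHl hHu D hDm hDs hsym hco hco2 _ x y μD P N
    have hb : b₀ ≤ β := (le_max_left _ _).trans hβ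
    have h2 : (2 : ℝ) ≤ β := (le_max_right _ _).trans hβ
    have hβ0 : 0 < β := by linarith
    have hβ1 : 1 ≤ β := by linarith
    have hτ2 : β ^ (-(1 : ℝ)) ≤ 1 / 2 := by
      rw [Real.rpow_neg_one]
      have h := inv_anti₀ (by norm_num : (0 : ℝ) < 2) h2
      norm_num at h ⊢
      exact h
    obtain ⟨-, hsH, -, -, hs1⟩ := hside β hb H hH hHl hHu
    set s : ℝ := β ^ ((1 / 8 - θ / 4) - 1 / 2) with hsdef
    have hs0 : 0 ≤ s := Real.rpow_nonneg hβ0.le _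
    set PT := plaquettesTouching (boxEdges 4 (2 * H + 1)) with hPT
    -- the sup of `N` on `D`
    set ν : ℝ := Cg * (H : ℝ) ^ 6 * (1 + Real.log H) ^ m * s ^ 3 + max Cr 0 * β * (H : ℝ) ^ 4 * s ^ 5 with hν
    have hH1 : (1 : ℝ) ≤ H := by exact_mod_cast hH
    have hL0 : 0 ≤ 1 + Real.log (H : ℝ) := by have := Real.log_nonneg hH1; linarith
    have hν0 : 0 ≤ ν := by rw [hν]; positivity
    have supN : ∀ a ∈ D, |N a| ≤ ν := by
      intro a ha
      have h1 := hG H hH β s hs0 hsH a (hDs ha)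
      have h2 : |cubicVertex β H a + P a| ≤ max Cr 0 * β * (H : ℝ) ^ 4 * s ^ 5 :=
        (hrem H hH β hβ0 s hs0 a (hDs ha)).trans (by gcongr; exact le_max_left _ _)
      have e : N a = ((tiltU β H a - tiltU β H (-a)) / 2 + cubicVertex β H a) - (cubicVertex β H a + P a) := by
        show (tiltU β H a - tiltU β H (-a)) / 2 - P a = _; ring
      rw [e, hν]
      exact (abs_sub _ _).trans (add_le_add h1 h2)
    -- a common crude bound on `D` and measurability
    set Ball : ℝ := 116 + 4 + ν with hBall
    have hBall0 : 0 ≤ Ball := by rw [hBall]; linarith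
    have hs2 : s ^ 2 ≤ 1 := pow_le_one₀ hs0 hs1
    have bO : ∀ z : Site 4, ∀ a ∈ D, |chartPlaqCostOdd H z 1 2 a| ≤ Ball := fun z a _ =>
      (EdgeChartGaussian.abs_chartPlaqCostOdd_le H z 1 2 a).trans (by rw [hBall]; linarith)
    have bE : ∀ z : Site 4, ∀ a ∈ D, |chartPlaqCost H z 1 2 a - chartPlaqCostOdd H z 1 2 a| ≤ Ball := fun z a ha => by
      have e : chartPlaqCost H z 1 2 a - chartPlaqCostOdd H z 1 2 a = (chartPlaqCost H z 1 2 a + chartPlaqCost H z 1 2 (-a)) / 2 := by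
        unfold chartPlaqCostOdd; ring
      rw [e, abs_div, abs_two]
      have h1 := TiltSup.abs_chartPlaqCost_le hs0 hs1 (hDs ha) z 1 2
      have h2' := TiltSup.abs_chartPlaqCost_le hs0 hs1 ((EdgeChartGaussian.neg_mem_smallField_iff s a).2 (hDs ha)) z 1 2
      have h3 := abs_add_le (chartPlaqCost H z 1 2 a) (chartPlaqCost H z 1 2 (-a))
      rw [hBall]; nlinarith
    have bN : ∀ a ∈ D, |N a| ≤ Ball := fun a ha => (supN a ha).trans (by rw [hBall]; linarith)
    have mP : Measurable P := EdgeChartGaussian.measurable_of_polyCert (EdgeChartGaussian.polyCert_tripleFormSum H β PT Tc hTc)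
    have mN : Measurable N := (((GaussNormalForm.measurable_tiltU β H).sub ((GaussNormalForm.measurable_tiltU β H).comp measurable_neg)).div_const 2).sub mP
    have mO : ∀ z : Site 4, Measurable (chartPlaqCostOdd H z 1 2) := fun z => EdgeChartGaussian.measurable_chartPlaqCostOdd H z 1 2
    have mE : ∀ z : Site 4, Measurable fun a => chartPlaqCost H z 1 2 a - chartPlaqCostOdd H z 1 2 a := fun z =>
      (EdgeChartGaussian.measurable_chartPlaqCost H z 1 2).sub (mO z)
    -- the two pieces
    have t1 := GaussRestrict.abs_tiltCum3_muSet_zero_le_of_sup_third hβ0 hDm hco hτ2 N hBall0 hν0 (mE x) (mO y) mN (bE x) (bO y) bN supN 0 0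
    have t2 := GaussRestrict.abs_tiltCum3_muSet_zero_le_of_sup_third hβ0 hDm hco hτ2 N hBall0 hν0 (mO x) (mE y) mN (bO x) (bE y) bN supN 0 0
    -- Gaussian letters
    have gE : ∀ z : Site 4, Real.sqrt (2 * gaussAvg β H (fun a => D.indicator (fun _ => (1 : ℝ)) a * (chartPlaqCost H z 1 2 a - chartPlaqCostOdd H z 1 2 a - 0) ^ 2)) ≤
        Real.sqrt 2 * 116 * s ^ 2 := fun z => sqrt_two_mul_gaussAvg_indicator_even_sq_le H hβ0 hs0 hs1 hDs z
    have gO : ∀ z : Site 4, Real.sqrt (2 * gaussAvg β H (fun a => D.indicator (fun _ => (1 : ℝ)) a * (chartPlaqCostOdd H z 1 2 a - 0) ^ 2)) ≤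
        Real.sqrt (2 * CL) * (β ^ (-(1 : ℝ)) * Real.sqrt (β ^ (-(1 : ℝ)))) := fun z => hO H hH β hβ1 D z
    have hME : 0 ≤ Real.sqrt 2 * 116 * s ^ 2 := by positivity
    have hMO : 0 ≤ Real.sqrt (2 * CL) * (β ^ (-(1 : ℝ)) * Real.sqrt (β ^ (-(1 : ℝ)))) := by positivity
    have piece : ∀ {t u v Mu Mv : ℝ}, t ≤ 2 * ν * u * v → 0 ≤ u → 0 ≤ v → 0 ≤ Mu → u ≤ Mu → v ≤ Mv → t ≤ 2 * ν * Mu * Mv := by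
      intro t u v Mu Mv ht hu hv hMu hu' hv'
      refine ht.trans ?_
      have h1 : 2 * ν * u * v ≤ 2 * ν * Mu * v := mul_le_mul_of_nonneg_right (mul_le_mul_of_nonneg_left hu' (by positivity)) hv
      exact h1.trans (mul_le_mul_of_nonneg_left hv' (by positivity))
    have e1 := piece t1 (Real.sqrt_nonneg _) (Real.sqrt_nonneg _) hME (gE x) (gO y)
    have e2 := piece t2 (Real.sqrt_nonneg _) (Real.sqrt_nonneg _) hMO (gO x) (gE y)
    refine (abs_add_le _ _).trans ?_
    have hsum := add_le_add e1 e2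
    refine hsum.trans (le_of_eq ?_)
    dsimp only
    rw [hν, hsdef, Real.rpow_one]; ring
  · intro ε hε
    have hε' : 0 < ε / 2 := half_pos hε
    have hc1 : (14 : ℕ) * θ + (1 / 2 : ℝ) < (5 : ℕ) * (1 / 2 - (1 / 8 - θ / 4)) := by push_cast; linarith
    have hc2 : (12 : ℕ) * θ + (3 / 2 : ℝ) < (7 : ℕ) * (1 / 2 - (1 / 8 - θ / 4)) := by push_cast; linarith
    obtain h₁ := budget_monomial (k := 14) (j := 5) (a := 1 / 2) (κ₃ := 1 / 8 - θ / 4) hθ.le hc1 hε'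
      (4 * Cg * (Real.sqrt 2 * 116) * Real.sqrt (2 * CL)) m
    obtain h₂ := budget_monomial (k := 12) (j := 7) (a := 3 / 2) (κ₃ := 1 / 8 - θ / 4) hθ.le hc2 hε'
      (4 * max Cr 0 * (Real.sqrt 2 * 116) * Real.sqrt (2 * CL)) 0
    obtain ⟨β₀, hβ₀, hall⟩ := exists_forall_and h₁ h₂
    refine ⟨β₀, hβ₀, fun β hβ H hH hHu => ?_⟩
    obtain ⟨e₁, e₂⟩ := hall β hβ H
    replace e₁ := e₁ hH hHu
    replace e₂ := e₂ hH hHu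
    simp only [pow_zero, mul_one] at e₂
    have hβ0 : 0 < β := by linarith
    have hsq : Real.sqrt (β ^ (-(1 : ℝ))) = β ^ (-(1 / 2 : ℝ)) := by
      rw [Real.sqrt_eq_rpow, ← Real.rpow_mul hβ0.le]; norm_num
    have hb2 : (β : ℝ) ^ 2 = β ^ (2 : ℝ) := by rw [← Real.rpow_natCast]; norm_num
    have hm1 : β ^ (1 / 2 : ℝ) = β ^ (2 : ℝ) * β ^ (-(1 : ℝ)) * β ^ (-(1 / 2 : ℝ)) := by
      rw [← Real.rpow_add hβ0, ← Real.rpow_add hβ0]; norm_num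
    have hm2 : β ^ (3 / 2 : ℝ) = β ^ (2 : ℝ) * β ^ (1 : ℝ) * β ^ (-(1 : ℝ)) * β ^ (-(1 / 2 : ℝ)) := by
      rw [← Real.rpow_add hβ0, ← Real.rpow_add hβ0, ← Real.rpow_add hβ0]; norm_num
    set s : ℝ := β ^ ((1 / 8 - θ / 4) - 1 / 2) with hs
    have hid : β ^ 2 * (H : ℝ) ^ 8 * (4 * (Cg * (H : ℝ) ^ 6 * (1 + Real.log H) ^ m * s ^ 3 + max Cr 0 * β ^ (1 : ℝ) * (H : ℝ) ^ 4 * s ^ 5) *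
        (Real.sqrt 2 * 116 * s ^ 2) * (Real.sqrt (2 * CL) * (β ^ (-(1 : ℝ)) * Real.sqrt (β ^ (-(1 : ℝ)))))) =
        4 * Cg * (Real.sqrt 2 * 116) * Real.sqrt (2 * CL) * (H : ℝ) ^ 14 * (1 + Real.log H) ^ m * s ^ 5 * β ^ (1 / 2 : ℝ) +
          4 * max Cr 0 * (Real.sqrt 2 * 116) * Real.sqrt (2 * CL) * (H : ℝ) ^ 12 * s ^ 7 * β ^ (3 / 2 : ℝ) := by
      rw [hsq, hb2, hm1, hm2]; ring
    rw [hid]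
    linarith

end K3RowSum

end Summit.QuantumFields.YangMills.Theorems.AllWindowsColdBoxBoxHighLine

end
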